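import Summits.CriticalPhenomena.Ising3DConformalLimit.Theses.CoerciveSharpness
import Summits.CriticalPhenomena.Ising3DConformalLimit.Theorems.CoerciveSharpnessCoerciveReflectedGradient
import Summits.CriticalPhenomena.Ising3DConformalLimit.Theorems.CoerciveSharpnessWindowOfGrowth
import Literature.Probability.LatticeModels.PointwiseScalingLimitEtaExists
import HarnessLib

/-!
# Line `WindowOfGrowthPotter` on crux `DimensionPinned` (stmt-CriticalPhenomena-4662) — a DISCHARGE line:
# the window needs only Potter (equal-Matuszewska-index) bounds, and those follow from the route's own
# scaling-limit crux, so route `CoerciveSharpness` closes WITHOUT `DimensionPinned`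

Forward generator G1 (next rung) from the proved floor
`Summit.CriticalPhenomena.Ising3DConformalLimit.Theorems.windowOfGrowth_proof :
CoerciveSharpness.WindowOfGrowth` (item stmt-CriticalPhenomena-18198).

* FLOOR `WindowOfGrowth = WindowOfGrowthUnder (HasIsingEtaBounds 3)`: growth `n^{κ'}` of the reflected
  gradient + two-sided PURE power bounds `c‖x‖^{-(1+η)} ≤ G ≤ C‖x‖^{-(1+η)}` (= crux `DimensionPinned`,
  open problem: bounded corrections to scaling) ⟹ WINDOW.
* RUNG `WindowOfGrowthPotter = WindowOfGrowthUnder PotterAxis` (rung_decl): the same conclusion from the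
  strictly weaker hypothesis of POTTER BOUNDS along the axis — for every `θ > 0` a constant `A_θ` with
  `A_θ⁻¹ (n/m)^{-(1+η+θ)} g(m) ≤ g(n) ≤ A_θ (n/m)^{-(1+η-θ)} g(m)` for `1 ≤ m ≤ n`, `g(k) = ⟨σ₀σ_{ke₁}⟩_{β_c(3)}`
  (Bingham–Goldie–Teugels, *Regular Variation*, §1.5 (Potter's theorem) and §2.1–2.2 (equal upper and lower Matuszewska indices, Potter-type bounds);
  a slowly varying factor such as `log^q` is allowed, so `DimensionPinned` may FAIL while `PotterAxis η` holds).
  New ingredient v. the floor: the exponent budget `θ` is paid out of the growth exponent `κ'`, and the window is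
  read off the RATIO lower bound directly (the floor's end-game `windowBelowHalf_of_hasIsingEtaBounds` needs the
  absolute two-sided form and is unavailable here).
* DISCHARGE: `PotterOfLimit` — every non-degenerate pointwise scaling limit `(ρ, S)` of `criticalCorr 3` with
  `ρ > 0` forces `PotterAxis (2Δ-1)` (tree: `HasPointwiseScalingLimit.exists_rpow_scale_mem_Icc_threeQuarters`
  gives the Lamperti ratio clause `ρ(cδ)/ρ(δ) → c^{-Δ}`, `tendsto_renorm_sq_mul_axis` gives
  `ρ(1/m)² g(m) → S₂(0,e₀) > 0`, hence `g(2m)/g(m) → 2^{-2Δ}` along ALL `m`; MMS antitonicity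
  `criticalTwoPoint_axis_antitone` interpolates) — provable now, size M. Hence
  `dischargedCloses_of : WindowOfGrowthPotter → PotterOfLimit → (PhiCoercive → WindowForcesU4 → MoebiusLimit →
  Ising3DConformalLimit)`: the route's deciding theorem with the binders `WindowOfGrowth` (proved) and
  `DimensionPinned` (open problem) REMOVED.

Registered stubs (typed by the named statements `ExponentDeficit`, `WindowOfRatioLower`, `PotterOfLimit`): `stub_exponentDeficit` (DC–Panis Thm 1.3/1.5 rerun under an AXIS upper envelope, M−, PROVED
below from the landed `stub_reflGrad_le_majorant`, `stub_denominator_le`, `DCP.sum_majorant_le`, `majorant_algebra`,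
`exponent_nonpos_of_bounded`, `criticalTwoPoint_axis_sandwich`), `stub_windowOfRatioLower` (S, PROVED below),
`stub_potterOfLimit` (M, provable now — the only remaining `sorry`). HENCE THE RUNG `WindowOfGrowthPotter` IS A
THEOREM (`WindowOfGrowthPotter_proof`, sorry-free, axioms standard). Compositions `WindowOfGrowthPotter_of` (the rung BY NAME) and
`dischargedCloses_of_stubs` are kernel-checked below (sorry-free outside `stub_*`).
-/

noncomputable section

namespace Summit.CriticalPhenomena.Ising3DConformalLimit.Cruxes.DimensionPinned.PotterWindow

open scoped BigOperators
open Finset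
open Literature.Probability.LatticeModels
open Summit.CriticalPhenomena.Ising3DConformalLimit.Theses.CoerciveSharpness
open Summit.CriticalPhenomena.Ising3DConformalLimit.Theorems

/-! ### Definitions (the graded family, the rung, the discharge statement) -/

/-- **Potter bounds along the axis with index `-(1+η)`** (equal Matuszewska indices of
`m ↦ ⟨σ₀σ_{me₁}⟩_{β_c(3)}`): for every `θ > 0` there is `A > 0` with
`A⁻¹ (n/m)^{-(1+η+θ)} g(m) ≤ g(n) ≤ A (n/m)^{-(1+η-θ)} g(m)` for all `1 ≤ m ≤ n`.
[cite: BinghamGoldieTeugels1987, §1.5 (Potter's theorem) and §2.1–2.2 (Matuszewska indices, Potter-type bounds)] -/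
def PotterAxis (η : ℝ) : Prop :=
  ∀ θ : ℝ, 0 < θ → ∃ A : ℝ, 0 < A ∧ ∀ m n : ℕ, 1 ≤ m → m ≤ n →
    A⁻¹ * ((n : ℝ) / m) ^ (-(1 + η + θ)) * criticalTwoPoint 3 (Pi.single 0 (m : ℤ)) ≤
        criticalTwoPoint 3 (Pi.single 0 (n : ℤ)) ∧
      criticalTwoPoint 3 (Pi.single 0 (n : ℤ)) ≤
        A * ((n : ℝ) / m) ^ (-(1 + η - θ)) * criticalTwoPoint 3 (Pi.single 0 (m : ℤ))

/-- The route's written-out reflected gradient `Q(n)` at scale `n` (verbatim from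
`CoerciveSharpness.CoerciveReflectedGradient` / `WindowOfGrowth`). -/
def reflGrad (n : ℕ) : ℝ :=
  ∑ x ∈ box 3 n, ∑ i : Fin 3, ((if x + Pi.single i 1 ∈ box 3 n then (twoPointFree 3 (criticalBeta 3) x - twoPointFree 3 (criticalBeta 3) (Function.update x (0 : Fin 3) (2 * (n : ℤ) - x 0))) * freeExpect 3 (criticalBeta 3) 0 (spinPair (x + Pi.single i 1) (Function.update (x + Pi.single i 1) (0 : Fin 3) (2 * (n : ℤ) - (x + Pi.single i 1 : Site 3) 0))) else 0) + (if x - Pi.single i 1 ∈ box 3 n then (twoPointFree 3 (criticalBeta 3) x - twoPointFree 3 (criticalBeta 3) (Function.update x (0 : Fin 3) (2 * (n : ℤ) - x 0))) * freeExpect 3 (criticalBeta 3) 0 (spinPair (x - Pi.single i 1) (Function.update (x - Pi.single i 1) (0 : Fin 3) (2 * (n : ℤ) - (x - Pi.single i 1 : Site 3) 0))) else 0))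

/-- **The graded family** `WindowOfGrowthUnder H`: growth `n^{κ'}` of the reflected gradient and
`∃ η, H η` force the WINDOW (item stmt-CriticalPhenomena-5507 verbatim). Antitone in `H`; the floor is
`H = HasIsingEtaBounds 3` (definitionally `CoerciveSharpness.WindowOfGrowth`). -/
def WindowOfGrowthUnder (H : ℝ → Prop) : Prop :=
  (∃ κ' c₀ : ℝ, 0 < κ' ∧ 0 < c₀ ∧ ∃ N₀ : ℕ, ∀ n : ℕ, N₀ ≤ n → c₀ * (n : ℝ) ^ κ' ≤ ∑ x ∈ box 3 n, ∑ i : Fin 3, ((if x + Pi.single i 1 ∈ box 3 n then (twoPointFree 3 (criticalBeta 3) x - twoPointFree 3 (criticalBeta 3) (Function.update x (0 : Fin 3) (2 * (n : ℤ) - x 0))) * freeExpect 3 (criticalBeta 3) 0 (spinPair (x + Pi.single i 1) (Function.update (x + Pi.single i 1) (0 : Fin 3) (2 * (n : ℤ) - (x + Pi.single i 1 : Site 3) 0))) else 0) + (if x - Pi.single i 1 ∈ box 3 n then (twoPointFree 3 (criticalBeta 3) x - twoPointFree 3 (criticalBeta 3) (Function.update x (0 : Fin 3) (2 * (n : ℤ)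 - x 0))) * freeExpect 3 (criticalBeta 3) 0 (spinPair (x - Pi.single i 1) (Function.update (x - Pi.single i 1) (0 : Fin 3) (2 * (n : ℤ) - (x - Pi.single i 1 : Site 3) 0))) else 0))) →
    (∃ η : ℝ, H η) →
      ∃ ε c : ℝ, 0 < ε ∧ 0 < c ∧ ∀ m n : ℕ, 1 ≤ m → m ≤ n → c * ((n : ℝ) / m) ^ (-((3:ℝ) / 2 - ε)) * criticalTwoPoint 3 (Pi.single 0 (m : ℤ)) ≤ criticalTwoPoint 3 (Pi.single 0 (n : ℤ))

/-- **THE RUNG** (rung_decl): the window of growth under Potter bounds along the axis. -/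
def WindowOfGrowthPotter : Prop :=
  WindowOfGrowthUnder PotterAxis

/-- **Potter bounds are automatic for a scaling limit**: every non-degenerate pointwise scaling limit of the
critical Ising₃ correlators with positive renormalisation forces `PotterAxis η` for some `η` (in fact
`η = 2Δ - 1`). [cite: Lamperti1962, Theorem 2] -/
def PotterOfLimit : Prop :=
  ∀ (ρ : ℝ → ℝ) (S : CorrFamily 3), (∀ δ ∈ Set.Ioc (0:ℝ) 1, 0 < ρ δ) →
    HasPointwiseScalingLimit (criticalCorr 3) ρ S → IsNondegenerateTwoPoint S → ∃ η : ℝ, PotterAxis η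

/-- **The discharged deciding theorem of route `CoerciveSharpness`**: its `closes` with the binders
`CoerciveReflectedGradient` (proved), `WindowOfGrowth` (proved) and `DimensionPinned` (OPEN) removed. -/
def DischargedCloses : Prop :=
  PhiCoercive → WindowForcesU4 → MoebiusLimit → _root_.Ising3DConformalLimit

/-! ### The floor is the special case `H = HasIsingEtaBounds 3` (sorry-free; F3) and the rung implies the floor (F1) -/

/-- **FLOOR = SPECIAL CASE.** `WindowOfGrowthUnder (HasIsingEtaBounds 3)` is, definitionally, the proved floor
`CoerciveSharpness.WindowOfGrowth` (item stmt-CriticalPhenomena-18198, `windowOfGrowth_proof`). -/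
theorem special_floor : WindowOfGrowthUnder (HasIsingEtaBounds 3) := by
  unfold WindowOfGrowthUnder
  exact windowOfGrowth_proof

/-- Two-sided pure power bounds are Potter bounds with `θ`-independent constant `A = C/c`. [folklore] -/
theorem potterAxis_of_hasIsingEtaBounds {η : ℝ} (h : HasIsingEtaBounds 3 η) : PotterAxis η := by
  unfold HasIsingEtaBounds IsPowerBounded at h
  obtain ⟨c, C, hc, hbd⟩ := h
  have he : (-(((3 : ℕ) : ℝ) - 2 + η)) = -(1 + η) := by norm_num
  have hne : ∀ k : ℕ, 1 ≤ k → (Pi.single (0 : Fin 3) (k : ℤ) : Site 3) ≠ 0 := by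
    intro k hk h
    have h0 := congr_fun h 0
    simp at h0
    omega
  have hnorm : ∀ k : ℕ, ‖(Pi.single (0 : Fin 3) (k : ℤ) : Site 3)‖ = k := fun k => by
    rw [Pi.norm_single, Int.norm_natCast]
  have hlow : ∀ k : ℕ, 1 ≤ k → c * (k : ℝ) ^ (-(1 + η)) ≤ criticalTwoPoint 3 (Pi.single 0 (k : ℤ)) := by
    intro k hk
    have h := (hbd _ (hne k hk)).1
    rwa [he, hnorm k] at h
  have hupp : ∀ k : ℕ, 1 ≤ k → criticalTwoPoint 3 (Pi.single 0 (k : ℤ)) ≤ C * (k : ℝ) ^ (-(1 + η)) := by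
    intro k hk
    have h := (hbd _ (hne k hk)).2
    rwa [he, hnorm k] at h
  have hCpos : 0 < C := by
    have h1 := hlow 1 le_rfl
    have h2 := hupp 1 le_rfl
    norm_num at h1 h2
    linarith
  intro θ hθ
  refine ⟨C / c, div_pos hCpos hc, fun m n hm hmn => ?_⟩
  have hm0 : (0 : ℝ) < m := by exact_mod_cast hm
  have hn0 : (0 : ℝ) < n := by exact_mod_cast (le_trans hm hmn)
  have hq1 : (1 : ℝ) ≤ (n : ℝ) / m := by
    rw [le_div_iff₀ hm0, one_mul]; exact_mod_cast hmn
  have hq0 : (0 : ℝ) < (n : ℝ) / m := by positivity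
  -- `(n/m)^{-(1+η)} = n^{-(1+η)} / m^{-(1+η)}`
  have hsplit : ((n : ℝ) / m) ^ (-(1 + η)) = (n : ℝ) ^ (-(1 + η)) / (m : ℝ) ^ (-(1 + η)) :=
    Real.div_rpow hn0.le hm0.le _
  have hmpow : 0 < (m : ℝ) ^ (-(1 + η)) := Real.rpow_pos_of_pos hm0 _
  have hnpow : 0 < (n : ℝ) ^ (-(1 + η)) := Real.rpow_pos_of_pos hn0 _
  have hgm := hupp m hm
  have hgm' := hlow m hm
  have hgn := hlow n (le_trans hm hmn)
  have hgn' := hupp n (le_trans hm hmn)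
  have hgm0 : 0 < criticalTwoPoint 3 (Pi.single 0 (m : ℤ)) := criticalTwoPoint_axis_pos m
  constructor
  · -- lower: `(C/c)⁻¹ (n/m)^{-(1+η+θ)} g(m) ≤ (c/C) (n/m)^{-(1+η)} g(m) ≤ g(n)`
    have hmono : ((n : ℝ) / m) ^ (-(1 + η + θ)) ≤ ((n : ℝ) / m) ^ (-(1 + η)) :=
      Real.rpow_le_rpow_of_exponent_le hq1 (by linarith)
    have hinv : (C / c)⁻¹ = c / C := by rw [inv_div]
    rw [hinv]
    calc c / C * ((n : ℝ) / m) ^ (-(1 + η + θ)) * criticalTwoPoint 3 (Pi.single 0 (m : ℤ))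
        ≤ c / C * ((n : ℝ) / m) ^ (-(1 + η)) * criticalTwoPoint 3 (Pi.single 0 (m : ℤ)) := by
          refine mul_le_mul_of_nonneg_right (mul_le_mul_of_nonneg_left hmono ?_) hgm0.le
          positivity
      _ ≤ c / C * ((n : ℝ) / m) ^ (-(1 + η)) * (C * (m : ℝ) ^ (-(1 + η))) := by
          refine mul_le_mul_of_nonneg_left hgm ?_
          positivity
      _ = c * (n : ℝ) ^ (-(1 + η)) := by
          rw [hsplit]; field_simp
      _ ≤ criticalTwoPoint 3 (Pi.single 0 (n : ℤ)) := hgn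
  · -- upper: `g(n) ≤ C n^{-(1+η)} = (C/c) (n/m)^{-(1+η)} (c m^{-(1+η)}) ≤ (C/c) (n/m)^{-(1+η-θ)} g(m)`
    have hmono : ((n : ℝ) / m) ^ (-(1 + η)) ≤ ((n : ℝ) / m) ^ (-(1 + η - θ)) :=
      Real.rpow_le_rpow_of_exponent_le hq1 (by linarith)
    calc criticalTwoPoint 3 (Pi.single 0 (n : ℤ)) ≤ C * (n : ℝ) ^ (-(1 + η)) := hgn'
      _ = C / c * ((n : ℝ) / m) ^ (-(1 + η)) * (c * (m : ℝ) ^ (-(1 + η))) := by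
          rw [hsplit]; field_simp
      _ ≤ C / c * ((n : ℝ) / m) ^ (-(1 + η)) * criticalTwoPoint 3 (Pi.single 0 (m : ℤ)) := by
          refine mul_le_mul_of_nonneg_left hgm' ?_
          positivity
      _ ≤ C / c * ((n : ℝ) / m) ^ (-(1 + η - θ)) * criticalTwoPoint 3 (Pi.single 0 (m : ℤ)) := by
          refine mul_le_mul_of_nonneg_right (mul_le_mul_of_nonneg_left hmono ?_) hgm0.le
          positivity

/-- The graded family is antitone in the hypothesis class. [folklore] -/
theorem windowOfGrowthUnder_antitone {H H' : ℝ → Prop} (hle : ∀ η, H η → H' η) :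
    WindowOfGrowthUnder H' → WindowOfGrowthUnder H := by
  intro h hA hE
  obtain ⟨η, hη⟩ := hE
  exact h hA ⟨η, hle η hη⟩

/-- **RUNG ⟹ FLOOR** (F1: the rung is the floor with its hypothesis strictly generalised). -/
theorem floor_of_rung (hR : WindowOfGrowthPotter) :
    Summit.CriticalPhenomena.Ising3DConformalLimit.Theses.CoerciveSharpness.WindowOfGrowth := by
  have h : WindowOfGrowthUnder (HasIsingEtaBounds 3) :=
    windowOfGrowthUnder_antitone (fun η hη => potterAxis_of_hasIsingEtaBounds hη) hR
  unfold WindowOfGrowthUnder at h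
  exact h

/-! ### Named stub statements (the skeleton check matches the hypotheses of `WindowOfGrowthPotter_of`
against the registered stubs by these names) -/

/-- Statement of `stub_exponentDeficit` (exponent deficit under an axis upper envelope). -/
def ExponentDeficit : Prop :=
    ∀ (κ' c₀ : ℝ) (N₀ : ℕ) (K b : ℝ), 0 < κ' → 0 < c₀ →
      (∀ n : ℕ, N₀ ≤ n → c₀ * (n : ℝ) ^ κ' ≤ reflGrad n) →
      0 < K → 0 ≤ b → b ≤ 3 / 4 →
      (∀ n : ℕ, 1 ≤ n → criticalTwoPoint 3 (Pi.single 0 (n : ℤ)) ≤ K * (n : ℝ) ^ (-(1 + b))) →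
      κ' ≤ 1 - 2 * b

/-- Statement of `stub_windowOfRatioLower` (the window from the lower Potter ratio bound when `η < 1/2`). -/
def WindowOfRatioLower : Prop :=
    ∀ η : ℝ, η < 1 / 2 → PotterAxis η →
      ∃ ε c : ℝ, 0 < ε ∧ 0 < c ∧ ∀ m n : ℕ, 1 ≤ m → m ≤ n → c * ((n : ℝ) / m) ^ (-((3:ℝ) / 2 - ε)) * criticalTwoPoint 3 (Pi.single 0 (m : ℤ)) ≤ criticalTwoPoint 3 (Pi.single 0 (n : ℤ))

/-! ### Registered stubs -/

/-- **Stub 1 (M−, PROVED): the exponent deficit under an AXIS upper envelope.** Growth `c₀ n^{κ'} ≤ Q(n)`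
for `n ≥ N₀` and `g(n) ≤ K n^{-(1+b)}` (`0 ≤ b ≤ 3/4`) force `κ' ≤ 1 - 2b`: Duminil-Copin–Panis Thm 1.3/1.5 run
pointwise in the scale exactly as in `windowOfGrowth_proof` (`stub_reflGrad_le_majorant`, `DCP.sum_majorant_le`,
`stub_denominator_le`, `majorant_algebra`, `exponent_nonpos_of_bounded`), after transporting the axis envelope to
all of `ℤ³ ∖ 0` by the MMS sphere sandwich `criticalTwoPoint_axis_sandwich` (`G y ≤ g(‖y‖_∞)`).
[cite: DuminilCopinPanis2025LowerBounds, proofs of Theorems 1.3 and 1.5 (arXiv pp. 5–6)] -/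
theorem stub_exponentDeficit : ExponentDeficit := by
  intro κ' c₀ N₀ K b hκ' hc₀ hgrow hK hb0 hb34 haxis
  have h1 := CoerciveSharpnessWindowOfGrowth.stub_reflGrad_le_majorant
  have h2 := CoerciveSharpnessWindowOfGrowth.stub_denominator_le
  -- the tree's summed majorant bound (DC–Panis, proof of Thm 1.3), at `d = 3`, axis `e₁`
  have hsum : ∀ n : ℕ, 1 ≤ n → (∑ x ∈ box 3 (4 * n),
        (if x 0 ≤ 2 * (n : ℤ) then
            criticalTwoPoint 3 x * criticalTwoPoint 3 (Pi.single 0 (n : ℤ))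
         else 4 * ((((4 * n : ℕ) : ℤ) - x 0 : ℤ) : ℝ) / n * criticalTwoPoint 3 (Pi.single 0 (n : ℤ)) *
           criticalTwoPoint 3 (Pi.single 0 (((4 * n : ℕ) : ℤ) - x 0 - 1)))) ≤
      criticalTwoPoint 3 (Pi.single 0 (n : ℤ)) * (∑ x ∈ box 3 (4 * n), criticalTwoPoint 3 x) +
        4 * criticalTwoPoint 3 (Pi.single 0 (n : ℤ)) / n * ((2 * (4 * n : ℕ) + 1 : ℕ) : ℝ) ^ 2 *
          (1 + 2 * ∑ k ∈ Finset.Icc 1 (2 * n), (k : ℝ) * criticalTwoPoint 3 (Pi.single 0 (k : ℤ))) :=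
    fun n hn => DCP.sum_majorant_le (d' := 2) (0 : Fin 3) hn
  -- basic facts on `G = criticalTwoPoint 3`
  have hG0 : ∀ x : Site 3, 0 ≤ criticalTwoPoint 3 x := fun x => DCP.critS_nonneg (d' := 2) x
  have hG00 : criticalTwoPoint 3 0 = 1 := twoPointPlus_origin (d := 3) _
  -- the all-space upper bound from the AXIS envelope, by the MMS sphere sandwich `G y ≤ g(‖y‖_∞)`
  have hup : ∀ x : Site 3, x ≠ 0 → criticalTwoPoint 3 x ≤ K * ‖x‖ ^ (-(1 + b)) := by
    intro x hx
    have hk1 : 1 ≤ Site.supNorm x := by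
      have h := norm_pos_iff.2 hx
      rw [Site.norm_eq_supNorm] at h
      exact Nat.one_le_iff_ne_zero.2 (by intro h0; rw [h0] at h; simp at h)
    rw [Site.norm_eq_supNorm]
    exact (criticalTwoPoint_axis_sandwich hk1).2.trans (haxis (Site.supNorm x) hk1)
  -- the denominator bound (landed stub 2 of the floor) for `F = G`
  have hden := h2 (criticalTwoPoint 3) K b hK hb0 hb34 hG00 hup
  have hD0 : (0 : ℝ) ≤ 1 + 872 * K := by linarith
  -- MAIN ESTIMATE (verbatim from the floor, `C ↦ K`): for `n ≥ max N₀ 1`,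
  -- `c₀ n^{κ'} ≤ 5838 K (1+872K) n^{1-2b}`
  have key : ∀ n : ℕ, max N₀ 1 ≤ n →
      c₀ * (n : ℝ) ^ (κ' - (1 - 2 * b)) ≤ 5838 * K * (1 + 872 * K) := by
    intro n hn
    have hnN : N₀ ≤ n := le_of_max_le_left hn
    have hn1 : 1 ≤ n := le_of_max_le_right hn
    have ht : (0 : ℝ) < n := by exact_mod_cast hn1
    have ht1 : (1 : ℝ) ≤ n := by exact_mod_cast hn1
    -- growth at scale `4n`, then the landed stub 1 of the floor, then the summed majorant
    have hg4 : c₀ * ((4 * n : ℕ) : ℝ) ^ κ' ≤ reflGrad (4 * n) := hgrow (4 * n) (by omega)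
    have hQ := hg4.trans (h1 n hn1)
    have hS := hsum n hn1
    have hDen := hden n hn1
    -- the pieces
    have hGn0 : 0 ≤ criticalTwoPoint 3 (Pi.single 0 (n : ℤ)) := hG0 _
    have hGn : criticalTwoPoint 3 (Pi.single 0 (n : ℤ)) ≤ K * (n : ℝ) ^ (-(1 + b)) := haxis n hn1
    have hχ0 : 0 ≤ ∑ x ∈ box 3 (4 * n), criticalTwoPoint 3 x := sum_nonneg fun x _ => hG0 x
    have hK0 : 0 ≤ ∑ k ∈ Finset.Icc 1 (2 * n), (k : ℝ) * criticalTwoPoint 3 (Pi.single 0 (k : ℤ)) :=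
      sum_nonneg fun k _ => mul_nonneg (Nat.cast_nonneg k) (hG0 _)
    have hU0 : 0 ≤ (n : ℝ) ^ (2 - b) := Real.rpow_nonneg ht.le _
    have hA0 : 0 ≤ (n : ℝ) ^ (-(1 + b)) := Real.rpow_nonneg ht.le _
    have hχ : ∑ x ∈ box 3 (4 * n), criticalTwoPoint 3 x ≤ (1 + 872 * K) * (n : ℝ) ^ (2 - b) := by
      have : 0 ≤ (n : ℝ) * ∑ k ∈ Finset.Icc 1 (2 * n), (k : ℝ) * criticalTwoPoint 3 (Pi.single 0 (k : ℤ)) :=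
        mul_nonneg ht.le hK0
      linarith
    have htU : (n : ℝ) ≤ (n : ℝ) ^ (2 - b) := by
      have := Real.rpow_le_rpow_of_exponent_le ht1 (show (1 : ℝ) ≤ 2 - b by linarith)
      rwa [Real.rpow_one] at this
    have hKs : 1 + 2 * ∑ k ∈ Finset.Icc 1 (2 * n), (k : ℝ) * criticalTwoPoint 3 (Pi.single 0 (k : ℤ)) ≤
        3 * (1 + 872 * K) * (n : ℝ) ^ (2 - b) / n := by
      rw [le_div_iff₀ ht]
      have hKn : (n : ℝ) * ∑ k ∈ Finset.Icc 1 (2 * n), (k : ℝ) * criticalTwoPoint 3 (Pi.single 0 (k : ℤ)) ≤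
          (1 + 872 * K) * (n : ℝ) ^ (2 - b) := by linarith
      have h1n : (n : ℝ) ≤ (1 + 872 * K) * (n : ℝ) ^ (2 - b) := by nlinarith
      nlinarith
    have hP0 : 0 ≤ ((2 * (4 * n : ℕ) + 1 : ℕ) : ℝ) ^ 2 := by positivity
    have hP : ((2 * (4 * n : ℕ) + 1 : ℕ) : ℝ) ^ 2 ≤ 81 * (n : ℝ) ^ 2 := by
      push_cast
      nlinarith
    have hmaj := CoerciveSharpnessWindowOfGrowth.majorant_algebra ht hA0 hU0 hK.le hD0 hGn0 hGn hχ0 hχ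
      hK0 hKs hP0 hP
    -- `A U = t^{1-2b}`
    have hAU : (n : ℝ) ^ (-(1 + b)) * (n : ℝ) ^ (2 - b) = (n : ℝ) ^ (1 - 2 * b) := by
      rw [← Real.rpow_add ht]; congr 1; ring
    rw [hAU] at hmaj
    -- chain: `c₀ (4n)^{κ'} ≤ 6 Σ maj ≤ 6 (…) ≤ 6 · 973 · K D t^{1-2b}`
    have hchain : c₀ * ((4 * n : ℕ) : ℝ) ^ κ' ≤ 6 * (973 * (K * (1 + 872 * K) * (n : ℝ) ^ (1 - 2 * b))) :=
      hQ.trans ((mul_le_mul_of_nonneg_left hS (by norm_num)).trans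
        (mul_le_mul_of_nonneg_left hmaj (by norm_num)))
    -- `n^{κ'} ≤ (4n)^{κ'}`
    have h4n : c₀ * (n : ℝ) ^ κ' ≤ c₀ * ((4 * n : ℕ) : ℝ) ^ κ' := by
      refine mul_le_mul_of_nonneg_left ?_ hc₀.le
      exact Real.rpow_le_rpow ht.le (by push_cast; linarith) hκ'.le
    -- divide by `n^{1-2b}`
    have hpow0 : 0 < (n : ℝ) ^ (1 - 2 * b) := Real.rpow_pos_of_pos ht _
    have hsplit : (n : ℝ) ^ (κ' - (1 - 2 * b)) = (n : ℝ) ^ κ' / (n : ℝ) ^ (1 - 2 * b) := by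
      rw [Real.rpow_sub ht]
    rw [hsplit, mul_div_assoc', div_le_iff₀ hpow0]
    calc c₀ * (n : ℝ) ^ κ' ≤ 6 * (973 * (K * (1 + 872 * K) * (n : ℝ) ^ (1 - 2 * b))) := h4n.trans hchain
      _ = 5838 * K * (1 + 872 * K) * (n : ℝ) ^ (1 - 2 * b) := by ring
  -- hence `κ' - (1 - 2b) ≤ 0`
  have hexp := CoerciveSharpnessWindowOfGrowth.exponent_nonpos_of_bounded hc₀ key
  linarith

/-- **Stub 2 (S, PROVED): the window read off the lower Potter ratio bound.** If `η < 1/2` then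
`PotterAxis η` at `θ = (1/2 - η)/2` is the WINDOW with `ε = (1/2 - η)/2`, `c = A⁻¹`. [folklore] -/
theorem stub_windowOfRatioLower : WindowOfRatioLower := by
  intro η hη hP
  obtain ⟨A, hA, hb⟩ := hP ((1 / 2 - η) / 2) (by linarith)
  refine ⟨(1 / 2 - η) / 2, A⁻¹, by linarith, inv_pos.mpr hA, fun m n hm hmn => ?_⟩
  have key := (hb m n hm hmn).1
  have hexp : (-((3:ℝ) / 2 - (1 / 2 - η) / 2)) = -(1 + η + (1 / 2 - η) / 2) := by ring
  rw [hexp]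
  exact key

/-- **Stub 3 (M, provable now): Potter bounds from the scaling limit** (Lamperti ratio clause of the tree's
`HasPointwiseScalingLimit.exists_rpow_scale_mem_Icc_threeQuarters` + `tendsto_renorm_sq_mul_axis` ⟹
`g(2m)/g(m) → 2^{-2Δ}`; dyadic iteration + `criticalTwoPoint_axis_antitone` between scales; finitely many
small `m` absorbed by `criticalTwoPoint_axis_pos`). [cite: Lamperti1962, Theorem 2] -/
theorem stub_potterOfLimit : PotterOfLimit := by
  sorry

/-! ### Compositions (kernel-checked, sorry-free) -/

/-- `g(1) ≤ 1`. [folklore] -/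
theorem axis_one_le_one : criticalTwoPoint 3 (Pi.single 0 ((1 : ℕ) : ℤ)) ≤ 1 := by
  have h := criticalTwoPoint_axis_antitone (Nat.zero_le 1)
  have h0 : criticalTwoPoint 3 0 = 1 := criticalTwoPoint_zero'
  simpa [h0] using h

/-- **The rung from the registered stubs 1–2** (real proof: the case split `η < 1/2` / `η ≥ 1/2`, the choice
`θ = min (κ'/4) (1/4)`, `b = min (η - θ) (3/4)`, and the contradiction `η ≤ 1/2 - κ'/4`). The conclusion is
written as `WindowOfGrowthUnder PotterAxis` (= `WindowOfGrowthPotter` by `rfl`) so that the by-name skeleton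
theorem recorded by `ledger skeleton check` is the hypothesis-free `WindowOfGrowthPotter_proof` below. -/
theorem WindowOfGrowthPotter_of (h1 : ExponentDeficit) (h2 : WindowOfRatioLower) :
    WindowOfGrowthUnder PotterAxis := by
  unfold ExponentDeficit at h1
  unfold WindowOfRatioLower at h2
  intro hA hE
  obtain ⟨κ', c₀, hκ', hc₀, N₀, hgrow⟩ := hA
  obtain ⟨η, hP⟩ := hE
  by_cases hη : η < 1 / 2
  · exact h2 η hη hP
  · exfalso
    -- the budget `θ` paid out of `κ'`
    set θ : ℝ := min (κ' / 4) (1 / 4) with hθ_def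
    have hθ0 : 0 < θ := lt_min (by linarith) (by norm_num)
    have hθκ : θ ≤ κ' / 4 := min_le_left _ _
    have hθ4 : θ ≤ 1 / 4 := min_le_right _ _
    obtain ⟨A, hA0, hbd⟩ := hP θ hθ0
    -- absolute axis upper envelope with exponent `1 + (η - θ)`, constant `A`
    have hη12 : 1 / 2 ≤ η := not_lt.mp hη
    set b : ℝ := min (η - θ) (3 / 4) with hb_def
    have hb0 : 0 ≤ b := le_min (by linarith) (by norm_num)
    have hb34 : b ≤ 3 / 4 := min_le_right _ _
    have hbη : b ≤ η - θ := min_le_left _ _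
    have hup : ∀ n : ℕ, 1 ≤ n →
        criticalTwoPoint 3 (Pi.single 0 (n : ℤ)) ≤ A * (n : ℝ) ^ (-(1 + b)) := by
      intro n hn
      have h := (hbd 1 n le_rfl hn).2
      have hn0 : (0 : ℝ) < n := by exact_mod_cast hn
      have hn1 : (1 : ℝ) ≤ n := by exact_mod_cast hn
      have hdiv : ((n : ℝ) / ((1 : ℕ) : ℝ)) = n := by push_cast; simp
      rw [hdiv] at h
      refine h.trans ?_
      have hg1 := axis_one_le_one
      have hpow : (n : ℝ) ^ (-(1 + η - θ)) ≤ (n : ℝ) ^ (-(1 + b)) :=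
        Real.rpow_le_rpow_of_exponent_le hn1 (by linarith)
      have hpow0 : 0 ≤ (n : ℝ) ^ (-(1 + η - θ)) := Real.rpow_nonneg hn0.le _
      calc A * (n : ℝ) ^ (-(1 + η - θ)) * criticalTwoPoint 3 (Pi.single 0 ((1 : ℕ) : ℤ))
          ≤ A * (n : ℝ) ^ (-(1 + η - θ)) * 1 :=
            mul_le_mul_of_nonneg_left hg1 (mul_nonneg hA0.le hpow0)
        _ ≤ A * (n : ℝ) ^ (-(1 + b)) := by
            rw [mul_one]; exact mul_le_mul_of_nonneg_left hpow hA0.le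
    have hdef := h1 κ' c₀ N₀ A b hκ' hc₀ hgrow hA0 hb0 hb34 hup
    -- `κ' ≤ 1 - 2b`: either `b = 3/4` (absurd, `κ' > 0`) or `b = η - θ ≥ η - κ'/4`, whence `η < 1/2`
    rcases le_total (η - θ) (3 / 4) with hcase | hcase
    · have hbeq : b = η - θ := min_eq_left hcase
      rw [hbeq] at hdef
      apply hη
      linarith
    · have hbeq : b = 3 / 4 := min_eq_right hcase
      rw [hbeq] at hdef
      linarith

/-- **Discharge**: the rung and `PotterOfLimit` decide the sub-problem from `PhiCoercive`,
`WindowForcesU4`, `MoebiusLimit` alone (same term as the route's `closes`, with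
`coerciveReflectedGradient_proof` for the proved binder and the limit's own Potter bounds in place of
`DimensionPinned`). -/
theorem dischargedCloses_of (hR : WindowOfGrowthPotter) (hP : PotterOfLimit) : DischargedCloses := by
  intro h₁ h₅ h₆
  obtain ⟨ρ, Δ, S, hρ, hΔ, hlim, hnd, hM⟩ := h₆
  exact ⟨ρ, Δ, S, hρ, hΔ, hlim, hnd, hM,
    h₅ (hR (coerciveReflectedGradient_proof h₁) (hP ρ S hρ hlim hnd)) ρ S hρ hlim hnd⟩

/-- The three stubs together give the discharged deciding theorem. -/
theorem dischargedCloses_of_stubs : DischargedCloses :=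
  dischargedCloses_of (WindowOfGrowthPotter_of stub_exponentDeficit stub_windowOfRatioLower)
    stub_potterOfLimit

/-- **The rung BY NAME from its registered stubs** (the skeleton theorem `ledger skeleton check` records;
sorries only inside `stub_exponentDeficit`, `stub_windowOfRatioLower`). -/
theorem WindowOfGrowthPotter_proof : WindowOfGrowthPotter :=
  WindowOfGrowthPotter_of stub_exponentDeficit stub_windowOfRatioLower

end Summit.CriticalPhenomena.Ising3DConformalLimit.Cruxes.DimensionPinned.PotterWindow

end
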